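import Summits.ResolutionOfSingularities.ResolutionOfSingularities.Theorems.RadicialJungCleanModelsGiraudStepPointStalk
import Summits.ResolutionOfSingularities.ResolutionOfSingularities.Theorems.RadicialJungCleanModelsGiraudChartCriticalPrimes
import HarnessLib

/-!
# Route `RadicialJung`, crux `CleanModels` (stmt-15917): Giraud's Lemme 2.3 at a point of the
# blow-up over the centre, STALK form, both charts (T2: `stub_lemma23`)

Support file (OURS) for PROGRAMME-clean-dim2 / T2, line `via-clean-models` of the crux
`DescentPerfectToAll` (stmt-0549). Nothing here is a statement of Hironaka's manuscript.

For the blowing up `π : X₁ → X` along `J` with `J_{π x′} = 𝔪` and a point `x′` of the blow-up,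
`R = im 𝒪_{X,π x′} ≤ T = im ε_{x′} ⊆ K(X)` (res-D-pv-030's scheme→chart bridge): with regular
parameters `(u, v)` lying in a `p`-basis, a germ `f ∉ 𝒪^p` with `c ≠ 0`, and the critical primes
at the two points given as "the height-one primes containing (the image of) the local equation
`g = u` or `g = uv` of `E(f)`" (res-D-pv-030's `…T2CriticalPrimesStalk.lean`), Giraud's
trichotomy holds: `c(x′) < c(π x′)`, or `c(x′) = c(π x′)` with `≠ 1` branch at `x′` and `1` branch
at `π x′`. The point `x′` is on the chart of `u` (`giraudColength_lt_of_chart`) or at the origin of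
the chart of `v` (`giraud23_trichotomy_of_oppositeChart_origin`), by `T2.chartAdjoin_le_or_origin`.

* `forall_mem_derivCriticalPrimes_iff_mem_of_ringEquiv` — transport of the "height-one primes
  containing `g`" description along a ring isomorphism;
* `giraud23_trichotomy_stalk` — **the trichotomy at the stalks**.

References: J. Giraud, Bull. SMF 111 (1983), Lemme 2.3 [Giraud1983].
-/

noncomputable section

set_option linter.dupNamespace false -- mandated namespace of this single-conjunct summit

open CategoryTheory AlgebraicGeometry TopologicalSpace IsLocalRing
open Literature.RingTheory.PBasis Literature.AlgebraicGeometry.Resolution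
open Summit.ResolutionOfSingularities.ResolutionOfSingularities.Theorems.RadicialJung.CleanModels.T2

namespace Summit.ResolutionOfSingularities.ResolutionOfSingularities.Theorems.RadicialJung.CleanModels

open Scheme.IdealSheafData

/-! ## Transport of "the critical primes are the height-one primes over `g`" -/

/-- If the critical primes of `f` are the height-one primes containing `g`, then the critical primes
of `e f` (`e : O ≃ O'`) are the height-one primes containing `e g`. [folklore] -/
theorem forall_mem_derivCriticalPrimes_iff_mem_of_ringEquiv {O O' : Type} [CommRing O] [CommRing O']
    (e : O ≃+* O') (f g : O)
    (h : ∀ P : Ideal O, P ∈ derivCriticalPrimes O f ↔ (P.IsPrime ∧ P.height = 1 ∧ g ∈ P)) :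
    ∀ P : Ideal O', P ∈ derivCriticalPrimes O' (e f) ↔ (P.IsPrime ∧ P.height = 1 ∧ e g ∈ P) := by
  intro P
  rw [derivCriticalPrimes_ringEquiv e, Set.mem_image]
  constructor
  · rintro ⟨P₀, hP₀, rfl⟩
    obtain ⟨hP, hh, hgP⟩ := (h P₀).mp hP₀
    haveI := hP
    exact ⟨Ideal.map_isPrime_of_equiv _, by rw [RingEquiv.height_map]; exact hh,
      Ideal.mem_map_of_mem _ hgP⟩
  · rintro ⟨hP, hh, hgP⟩
    haveI := hP
    refine ⟨P.map (e.symm : O' →+* O), (h _).mpr ⟨Ideal.map_isPrime_of_equiv _, ?_, ?_⟩, ?_⟩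
    · rw [Ideal.map_coe, RingEquiv.height_map]; exact hh
    · rw [Ideal.map_coe]
      have : e.symm (e g) ∈ P.map e.symm := Ideal.mem_map_of_mem _ hgP
      rwa [e.symm_apply_apply] at this
    · have := Ideal.map_of_equiv (I := P) e.symm
      rwa [RingEquiv.symm_symm] at this

/-! ## The trichotomy at the stalks -/

section Stalk

variable {X₁ X : Scheme.{0}} [IsIntegral X] [IsLocallyNoetherian X] {π : X₁ ⟶ X}
  {J : X.IdealSheafData}

/-- **Lemme 2.3 at the stalks (both charts).** For the blow-up `π` along `J` with `J_{π x′} = 𝔪`,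
regular parameters `(u, v)` of the two-dimensional regular stalk `𝒪_{X,π x′}` lying in a `p`-basis
`Γ₀`, `Ω` projective, `𝒪_{X₁,x′}` regular of dimension `2`, a germ `f₀ ∉ 𝒪^p` with `c ≠ 0`, and
the critical primes at `π x′` resp. `x′` = the height-one primes containing `g` resp. the image of
`g`, `g = u` or `g = uv`: `c(x′) < c(π x′)`, or `c(x′) = c(π x′)` with `≠ 1` branch at `x′` and
one branch at `π x′`. [cite: Giraud1983, Lemme 2.3 (i)–(iii)] -/
theorem giraud23_trichotomy_stalk (hπ : IsBlowup π J) (x' : X₁)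
    (hJ : stalkIdeal J (π x') = maximalIdeal (X.presheaf.stalk (π x')))
    [IsRegularLocalRing (X.presheaf.stalk (π x'))] [IsRegularLocalRing (X₁.presheaf.stalk x')]
    (hdim : ringKrullDim (X.presheaf.stalk (π x')) = 2)
    (hdim₁ : ringKrullDim (X₁.presheaf.stalk x') = 2)
    {p : ℕ} [Fact p.Prime] [CharP (X.presheaf.stalk (π x')) p]
    [Module.Projective (X.presheaf.stalk (π x')) Ω[X.presheaf.stalk (π x')⁄ℤ]]
    (u v : X.presheaf.stalk (π x')) (huv : maximalIdeal (X.presheaf.stalk (π x')) = Ideal.span {u, v})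
    (hne : u ≠ v) {Γ₀ : Set (X.presheaf.stalk (π x'))}
    (hΓ₀ : IsPBasisOver p (frobenius (X.presheaf.stalk (π x')) p).range Γ₀) (huΓ : u ∈ Γ₀)
    (hvΓ : v ∈ Γ₀)
    (f₀ : X.presheaf.stalk (π x')) (hf : f₀ ∉ (frobenius (X.presheaf.stalk (π x')) p).range)
    (hc : giraudColength (X.presheaf.stalk (π x')) f₀ ≠ 0)
    {g : X.presheaf.stalk (π x')} (hg : g = u ∨ g = u * v)
    (hcrit₀ : ∀ P : Ideal (X.presheaf.stalk (π x')),
      P ∈ derivCriticalPrimes (X.presheaf.stalk (π x')) f₀ ↔ (P.IsPrime ∧ P.height = 1 ∧ g ∈ P))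
    (hcrit₁ : ∀ P : Ideal (hπ.stalkEmb x').range,
      P ∈ derivCriticalPrimes (hπ.stalkEmb x').range
          ⟨algebraMap (X.presheaf.stalk (π x')) X.functionField f₀,
            range_algebraMap_le_range_stalkEmb hπ x' ⟨_, rfl⟩⟩ ↔
        (P.IsPrime ∧ P.height = 1 ∧
          (⟨algebraMap (X.presheaf.stalk (π x')) X.functionField g,
            range_algebraMap_le_range_stalkEmb hπ x' ⟨_, rfl⟩⟩ : (hπ.stalkEmb x').range) ∈ P)) :
    giraudColength (X₁.presheaf.stalk x') ((π.stalkMap x').hom f₀) <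
        giraudColength (X.presheaf.stalk (π x')) f₀ ∨
      (giraudColength (X₁.presheaf.stalk x') ((π.stalkMap x').hom f₀) =
          giraudColength (X.presheaf.stalk (π x')) f₀ ∧
        (derivCriticalPrimes (X₁.presheaf.stalk x') ((π.stalkMap x').hom f₀)).ncard ≠ 1 ∧
        (derivCriticalPrimes (X.presheaf.stalk (π x')) f₀).ncard = 1) := by
  classical
  haveI hRloc := isLocalRing_range_algebraMap_stalk (X := X) (π x')
  haveI hTloc := isLocalRing_range_stalkEmb hπ x'
  set K := X.functionField
  set R : Subring K := (algebraMap (X.presheaf.stalk (π x')) K).range with hRdef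
  set T : Subring K := (hπ.stalkEmb x').range with hTdef
  obtain ⟨e₀, he₀⟩ := exists_ringEquiv_range_stalk (X := X) (π := π) x'
  obtain ⟨e₁, he₁⟩ := exists_ringEquiv_range_stalkEmb hπ x'
  -- the elements
  set x : R := ⟨algebraMap _ K u, u, rfl⟩ with hxdef
  set y : R := ⟨algebraMap _ K v, v, rfl⟩ with hydef
  have he₀u : e₀ u = x := Subtype.ext (he₀ u)
  have he₀v : e₀ v = y := Subtype.ext (he₀ v)
  have hRT : R ≤ T := range_algebraMap_le_range_stalkEmb hπ x'
  have he₁_of : ∀ a : X.presheaf.stalk (π x'),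
      e₁ ((π.stalkMap x').hom a) = Subring.inclusion hRT (e₀ a) := by
    intro a
    apply Subtype.ext
    rw [he₁, Subring.coe_inclusion, he₀, hπ.stalkEmb_stalkMap]
  have hincl : ∀ a : X.presheaf.stalk (π x'), Subring.inclusion hRT (e₀ a) =
      ⟨algebraMap _ K a, range_algebraMap_le_range_stalkEmb hπ x' ⟨_, rfl⟩⟩ := fun a =>
    Subtype.ext (by rw [Subring.coe_inclusion, he₀])
  -- instances and data on `R`
  haveI : IsRegularLocalRing R := IsRegularLocalRing.of_ringEquiv e₀
  have hdimR : ringKrullDim R = 2 := by rw [← ringKrullDim_eq_of_ringEquiv e₀]; exact hdim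
  haveI : CharP R p := charP_of_injective_ringHom (f := (e₀ : X.presheaf.stalk (π x') →+* R))
    e₀.injective p
  haveI : Module.Projective R Ω[R⁄ℤ] := projective_kaehler_range_stalk (X := X) (π x')
  haveI : IsFractionRing R K := isFractionRing_range_stalk (X := X) (π x')
  -- instances and data on `T`
  haveI : IsRegularLocalRing T := IsRegularLocalRing.of_ringEquiv e₁
  have hdimT : ringKrullDim T = 2 := by rw [← ringKrullDim_eq_of_ringEquiv e₁]; exact hdim₁
  have hm : maximalIdeal R = Ideal.span {x, y} := maximalIdeal_range_eq_span_pair (π := π) x' u v huv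
  have hm' : maximalIdeal R = Ideal.span {y, x} := by rw [hm, Set.pair_comm]
  have huv' : maximalIdeal (X.presheaf.stalk (π x')) = Ideal.span {v, u} := by rw [huv, Set.pair_comm]
  have hxy : x ≠ y := fun h => hne (e₀.injective (by rw [he₀u, he₀v, h]))
  have hx0 : x ≠ 0 := fun h => fst_not_mem_sq hdimR hm (by rw [h]; exact Ideal.zero_mem _)
  have hy0 : y ≠ 0 := fun h => fst_not_mem_sq hdimR hm' (by rw [h]; exact Ideal.zero_mem _)
  have hu0 : u ≠ 0 := fun h => hx0 (by rw [← he₀u, h, map_zero])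
  have hv0 : v ≠ 0 := fun h => hy0 (by rw [← he₀v, h, map_zero])
  have hum : u ∈ maximalIdeal (X.presheaf.stalk (π x')) := huv ▸ Ideal.subset_span (by simp)
  have hvm : v ∈ maximalIdeal (X.presheaf.stalk (π x')) := huv ▸ Ideal.subset_span (by simp)
  -- the `p`-basis on `R` and its dual derivations
  have hΓ : IsPBasisOver p (frobenius R p).range (e₀ '' Γ₀) := IsPBasisOver.map_ringEquiv e₀ hΓ₀
  have hxΓ : x ∈ e₀ '' Γ₀ := ⟨u, huΓ, he₀u⟩
  have hyΓ : y ∈ e₀ '' Γ₀ := ⟨v, hvΓ, he₀v⟩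
  obtain ⟨δ, hδ₁, hδ₀⟩ := IsPBasisOver.exists_dual_derivations hΓ
  -- the germ and its invariants on `R`, the critical primes of `R`
  have hfR : e₀ f₀ ∉ (frobenius R p).range := by
    rintro ⟨r, hr⟩
    apply hf
    refine ⟨e₀.symm r, ?_⟩
    apply e₀.injective
    rw [frobenius_def, map_pow, RingEquiv.apply_symm_apply, ← frobenius_def, hr]
  have hcR : giraudColength R (e₀ f₀) ≠ 0 := by rwa [giraudColength_ringEquiv e₀ f₀]
  have hcritR := forall_mem_derivCriticalPrimes_iff_mem_of_ringEquiv e₀ f₀ g hcrit₀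
  have hf₁ : e₁ ((π.stalkMap x').hom f₀) = Subring.inclusion hRT (e₀ f₀) := he₁_of f₀
  -- the critical primes of `T`, with `f` and `g` written through `e₀`
  have hcritT : ∀ P : Ideal T, P ∈ derivCriticalPrimes T (Subring.inclusion hRT (e₀ f₀)) ↔
      (P.IsPrime ∧ P.height = 1 ∧ Subring.inclusion hRT (e₀ g) ∈ P) := by
    rw [hincl f₀, hincl g]; exact hcrit₁
  have he₀g₁ : g = u → e₀ g = x := fun h => by rw [h, he₀u]
  have he₀g₂ : g = u * v → e₀ g = x * y := fun h => by rw [h, map_mul, he₀u, he₀v]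
  -- derivation stability of `T` from a chart presentation `T = R[b/a]_Q`
  have hTstab : ∀ {a b : R} (hle : chartAdjoin (K := K) a b ≤ T)
      (_hTeq : T = (LocalSubring.ofPrime (chartAdjoin (K := K) a b)
        ((maximalIdeal T).comap (Subring.inclusion hle))).toSubring)
      (_hQp : ((maximalIdeal T).comap (Subring.inclusion hle)).IsPrime),
      ∀ D : Derivation ℤ K K, (∀ r : R, D r ∈ R) → D (((b : R) : K) / (a : R)) ∈ T →
        ∀ t : T, D t ∈ T := by
    intro a b hle hTeq hQp D hDR hDba
    have hDA : ∀ c : chartAdjoin (K := K) a b, D c ∈ T := by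
      intro c
      have hc : (c : K) ∈ Algebra.adjoin R {((b : R) : K) / (a : R)} := c.2
      refine Algebra.adjoin_induction (p := fun z _ => D z ∈ T) ?_ ?_ ?_ ?_ hc
      · intro t ht; rw [Set.mem_singleton_iff] at ht; rw [ht]; exact hDba
      · intro r; exact hRT (hDR r)
      · intro b' c' _ _ ihb ihc; rw [map_add]; exact T.add_mem ihb ihc
      · intro b' c' hb hc' ihb ihc
        rw [Derivation.leibniz, smul_eq_mul, smul_eq_mul]
        exact T.add_mem (T.mul_mem (hle hb) ihc) (T.mul_mem (hle hc') ihb)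
    refine derivation_mapsTo_of_fractions hle (fun t => ?_) D hDA
    have ht : (t : K) ∈ (LocalSubring.ofPrime (chartAdjoin (K := K) a b)
        ((maximalIdeal T).comap (Subring.inclusion hle))).toSubring := by
      rw [← hTeq]; exact t.2
    obtain ⟨c, s, hsQ, hts⟩ := (mem_ofPrime_iff (A := chartAdjoin (K := K) a b)
      (P := (maximalIdeal T).comap (Subring.inclusion hle))).mp ht
    refine ⟨c, s, ?_, ?_⟩
    · by_contra hsu
      exact hsQ ((mem_maximalIdeal _).mpr hsu)
    · have hs0 : ((s : chartAdjoin (K := K) a b) : K) ≠ 0 := by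
        intro h0
        apply hsQ
        have : s = 0 := Subtype.ext h0
        rw [this]; exact Ideal.zero_mem _
      rw [hts, div_mul_cancel₀ _ hs0]
  -- which chart?
  rcases chartAdjoin_le_or_origin hπ x' hJ u v huv with hle | ⟨hle, hzT, hzm⟩
  · ----------------------------------------------------------------- the chart of `u`
    change chartAdjoin (K := K) x y ≤ T at hle
    letI : Algebra (chartAdjoin (K := K) x y) T := (Subring.inclusion hle).toAlgebra
    have halgT : algebraMap (chartAdjoin (K := K) x y) T = Subring.inclusion hle := rfl
    haveI hlocT := isLocalization_atPrime_range_stalkEmb hπ x' hJ u v huv hu0 hle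
    set Q : Ideal (chartAdjoin (K := K) x y) := (maximalIdeal T).comap (Subring.inclusion hle)
      with hQ
    haveI hQmax : Q.IsMaximal :=
      isMaximal_comap_maximalIdeal_chartAdjoin hπ x' hJ u v huv hu0 hdim hdim₁ hle
    have hxQ : chartIncl x y x ∈ Q := chartIncl_mem_comap_maximalIdeal hπ x' u v hle hum
    have hyxT : ((y : R) : K) / x ∈ T := hle (Algebra.subset_adjoin (Set.mem_singleton _))
    have hTeq := range_stalkEmb_eq_ofPrime_chartAdjoin hπ x' hJ u v huv hu0 hle
    have hT : ∀ D : Derivation ℤ K K, (∀ r : R, D r ∈ R) → D (((y : R) : K) / x) ∈ T →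
        ∀ t : T, D t ∈ T := hTstab hle hTeq hQmax.isPrime
    left
    have hlt : giraudColength T (Subring.inclusion hRT (e₀ f₀)) < giraudColength R (e₀ f₀) := by
      refine giraudColength_lt_of_chart δ hδ₁ hδ₀ hxΓ hyΓ hdimR hm hxy hΓ hRT hle hyxT hT halgT Q
        hxQ (e₀ f₀) hfR hcR ?_
      rcases hg with hg | hg
      · left
        rw [he₀g₁ hg] at hcritR hcritT
        exact ⟨mem_derivCriticalPrimes_iff_of_rsop₁ hdimR hm _ hcritR,
          derivCriticalPrimes_chart_of_mem₁ hdimR hm hRT hle halgT Q hxQ _ hcritT⟩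
      · right
        rw [he₀g₂ hg] at hcritR hcritT
        rw [map_mul] at hcritT
        exact ⟨mem_derivCriticalPrimes_iff_of_rsop₂ hdimR hm _ hcritR,
          derivCriticalPrimes_chart_of_mem₂ hdimR hdimT hm hRT hle hyxT halgT Q hxQ _ hcritT⟩
    rw [← giraudColength_ringEquiv e₁ ((π.stalkMap x').hom f₀), ← giraudColength_ringEquiv e₀ f₀,
      hf₁]
    exact hlt
  · ----------------------------------------------------- the origin of the chart of `v`
    change chartAdjoin (K := K) y x ≤ T at hle
    letI : Algebra (chartAdjoin (K := K) y x) T := (Subring.inclusion hle).toAlgebra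
    have halgT : algebraMap (chartAdjoin (K := K) y x) T = Subring.inclusion hle := rfl
    haveI hlocT := isLocalization_atPrime_range_stalkEmb hπ x' hJ v u huv' hv0 hle
    set Q : Ideal (chartAdjoin (K := K) y x) := (maximalIdeal T).comap (Subring.inclusion hle)
      with hQ
    haveI hQmax : Q.IsMaximal :=
      isMaximal_comap_maximalIdeal_chartAdjoin hπ x' hJ v u huv' hv0 hdim hdim₁ hle
    have hyQ : chartIncl y x y ∈ Q := chartIncl_mem_comap_maximalIdeal hπ x' v u hle hvm
    have hxyT : ((x : R) : K) / y ∈ T := hle (Algebra.subset_adjoin (Set.mem_singleton _))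
    have hTeq := range_stalkEmb_eq_ofPrime_chartAdjoin hπ x' hJ v u huv' hv0 hle
    have hT : ∀ D : Derivation ℤ K K, (∀ r : R, D r ∈ R) → D (((x : R) : K) / y) ∈ T →
        ∀ t : T, D t ∈ T := hTstab hle hTeq hQmax.isPrime
    -- `x/y ∈ 𝔪_T`: `𝔪_T = (y, x/y)`, `(y) ≠ (x/y)`
    have hzm' : (⟨((x : R) : K) / y, hxyT⟩ : T) ∈ maximalIdeal T := hzm
    have hmT : maximalIdeal T = Ideal.span {Subring.inclusion hRT y, ⟨((x : R) : K) / y, hxyT⟩} :=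
      maximalIdeal_eq_span_pair_of_chart hm' hy0 hRT hle hxyT halgT Q hyQ hzm'
    have hneT := span_singleton_ne_of_chart_origin hdimT hRT hxyT hmT
    have h := giraud23_trichotomy_of_oppositeChart_origin δ hδ₁ hδ₀ hxΓ hyΓ hdimR hm hxy hΓ hRT hle
      hxyT hT halgT Q (e₀ f₀) hfR hcR hneT (by
        rcases hg with hg | hg
        · left
          rw [he₀g₁ hg] at hcritR hcritT
          exact ⟨mem_derivCriticalPrimes_iff_of_rsop₁ hdimR hm _ hcritR,
            derivCriticalPrimes_chart_origin_of_mem₁ hdimT hy0 hRT hxyT hmT _ hcritT⟩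
        · right
          rw [he₀g₂ hg] at hcritR hcritT
          rw [map_mul] at hcritT
          exact ⟨mem_derivCriticalPrimes_iff_of_rsop₂ hdimR hm _ hcritR,
            derivCriticalPrimes_chart_origin_of_mem₂ hdimT hy0 hRT hxyT hmT _ hcritT⟩)
    rw [← giraudColength_ringEquiv e₁ ((π.stalkMap x').hom f₀), ← giraudColength_ringEquiv e₀ f₀,
      ← ncard_derivCriticalPrimes_ringEquiv e₁ ((π.stalkMap x').hom f₀),
      ← ncard_derivCriticalPrimes_ringEquiv e₀ f₀, hf₁]
    exact h

end Stalk

end Summit.ResolutionOfSingularities.ResolutionOfSingularities.Theorems.RadicialJung.CleanModels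

end
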